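import Literature.Topology.FourManifolds.FishtailCapEnd
import Literature.Topology.FourManifolds.FishtailBaseCharts
import Literature.Topology.FourManifolds.GompfFramedTwistTransport
import Literature.Topology.FourManifolds.FishtailCoordinates
import HarnessLib

/-!
# Points of the product tube and of the cap-end charts as mapping-torus points

Infrastructure for the explicit fishtail neighbourhood (R. Gompf, *More Cappell–Shaneson spheres
are standard*, Algebr. Geom. Topol. 10 (2010), proof of Thm 2.1 and Lemma 2.2; the named fact
`Literature.Topology.FourManifolds.gompf2010_framedTwist`). The surgery `X^σ` of the mapping
torus `X_ψ` along its section circle uses the product tube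
`(u, w) ↦ [expT (univBall 0 ε w), s(u)]` (`GompfFramedTwistTransport.lean`). This file reads
those points through the real base lift `baseOf` (`FishtailBaseCharts.lean`):

* `prodTube_apply_eq_mtPt_baseOf` : `ν (u, w) = mtPt ψ (expT (univBall 0 ε w)) (baseOf (toC u))`
  for ALL `u` (the two charts `angA`/`angB` of the base circle are exactly the two branches of
  `baseOf`);
* `univBall_zero_smul_unit` : `univBall 0 ε (t • θ) = (ε t/√(1 + t²)) • θ` for a unit vector;
* `coe_bwdA_toE2` : the glued-back point `bwdA (toE2 d, θ)` is `[expT ((-capN ε d) • θ), baseOf d]`;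
  hence the cap-end charts (`capEnd`, `capEndN`, `FishtailCapEnd.lean`) read in the old piece:
  `capEnd_eq_inl_mtPt`, `capEndN_eq_inl_mtPt`.

Everything is proved; no named facts.

## References

* R. E. Gompf, *More Cappell–Shaneson spheres are standard*, Algebr. Geom. Topol. 10 (2010)
  1665–1681, §2 and proof of Thm 2.1. [GompfAGT2010]
-/

noncomputable section

open scoped Real ContDiff Topology Manifold
open Set Function Filter Complex Metric

namespace Literature.Topology.FourManifolds

local notation "𝔼 " n:arg => EuclideanSpace ℝ (Fin n)
local notation "𝕊 " n:arg => (Metric.sphere (0 : EuclideanSpace ℝ (Fin (n + 1))) 1)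
local notation "𝓣" =>
  (ModelWithCorners.prod (𝓡 1) (ModelWithCorners.prod (𝓡 1) (𝓡 1)))

/-! ### Scalars through `toC` and `baseOf` -/

section Scalars

/-- `toC` commutes with real scalars. [folklore] -/
theorem toC_smul (r : ℝ) (v : 𝔼 2) : toC (r • v) = r * toC v := by
  apply Complex.ext <;> simp [toC]

/-- `baseOf` is invariant under positive real scalars. [folklore] -/
theorem baseOf_real_mul {r : ℝ} (hr : 0 < r) (z : ℂ) : baseOf (r * z) = baseOf z := by
  have hre : (↑r * z).re = r * z.re := by simp
  rcases lt_or_ge z.re 0 with h | h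
  · have h' : (↑r * z).re < 0 := by rw [hre]; nlinarith
    rw [baseOf_of_neg h, baseOf_of_neg h', show -(↑r * z) = ↑r * (-z) by ring, arg_real_mul _ hr]
  · have h' : 0 ≤ (↑r * z).re := by rw [hre]; positivity
    rw [baseOf_of_nonneg h, baseOf_of_nonneg h', arg_real_mul _ hr]

/-- `baseOf` of a nonzero complex number only depends on its direction: `baseOf (e^{i arg d}) = baseOf d`. [folklore] -/
theorem baseOf_exp_arg {d : ℂ} (hd : d ≠ 0) : baseOf (exp (arg d * I)) = baseOf d := by
  have h : d = ‖d‖ * exp (arg d * I) := (norm_mul_exp_arg_mul_I d).symm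
  conv_rhs => rw [h]
  rw [baseOf_real_mul (norm_pos_iff.2 hd)]

end Scalars

/-! ### The product tube through `baseOf` -/

section ProdTube

variable (ψ : ThreeTorus ≃ₘ⟮𝓣, 𝓣⟯ ThreeTorus) {ε : ℝ} (hε : 0 < ε) (hεπ : ε ≤ π)
  (hψ : ∀ v : 𝔼 3, ‖v‖ < ε → ψ (expT v) = expT v)

/-- **The product tube read through `baseOf`**: `ν (u, w) = [expT (univBall 0 ε w), baseOf (toC u)]`
for every `u`. [folklore] -/
theorem prodTube_apply_eq_mtPt_baseOf (u : 𝕊 1) (w : 𝔼 3) :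
    (prodTube ψ ε hε hεπ hψ).toFun (u, w) =
      mtPt ψ (expT (OpenPartialHomeomorph.univBall (0 : 𝔼 3) ε w)) (baseOf (toC (u : 𝔼 2))) := by
  rcases lt_or_ge (toC (u : 𝔼 2)).re 0 with h | h
  · -- first cylinder, `angA`
    have hu : u ≠ ptA := by
      intro hu; rw [hu, toC_ptA] at h; simp at h; linarith
    have ha : 0 < angA u ∧ angA u < 1 := ⟨(angA_mem_Ioc u).1, angA_lt_one hu⟩
    have hb : baseOf (toC (u : 𝔼 2)) = angA u := by
      rw [baseOf_of_neg h]; unfold angA; ring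
    rw [prodTube_apply_of_ne ψ ε hε hεπ hψ hu, hb, mtPt_of_mem_one _ ha]
    congr 2
    exact Subtype.ext (coe_angAPt hu)
  · -- second cylinder, `angB`
    have hu : u ≠ ptB := by
      intro hu; rw [hu, toC_ptB] at h; simp at h; linarith
    have hbm : 1 / 2 < angB u ∧ angB u < 3 / 2 := ⟨(angB_mem_Ioc u).1, angB_lt hu⟩
    have hb : baseOf (toC (u : 𝔼 2)) = angB u := by
      rw [baseOf_of_nonneg h]; unfold angB; ring
    rw [prodTube_apply_of_ne_ptB ψ ε hε hεπ hψ hu, hb, mtPt_of_mem_two _ hbm]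
    congr 2
    exact Subtype.ext (coe_angBPt hu)

include hε in
/-- **The shrinking map on a ray**: `univBall 0 ε (t • θ) = (ε t/√(1 + t²)) • θ` for `‖θ‖ = 1`, `0 ≤ t`. [folklore] -/
theorem univBall_zero_smul_unit {t : ℝ} (ht : 0 ≤ t) {θ : 𝔼 3} (hθ : ‖θ‖ = 1) :
    OpenPartialHomeomorph.univBall (0 : 𝔼 3) ε (t • θ) = (ε * t / Real.sqrt (1 + t ^ 2)) • θ := by
  rw [univBall_zero_eq_smul hε, norm_smul, hθ, mul_one, Real.norm_of_nonneg ht, smul_smul, smul_smul]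
  congr 1
  field_simp

/-- **The glued-back point over the cap chart**: for `d ≠ 0`,
`bwdA (toE2 d, θ) = [expT ((-capN ε d) • θ), baseOf d]`. [folklore] -/
theorem coe_bwdA_toE2 {d : ℂ} (hd : d ≠ 0) (θ : 𝕊 2) :
    ((prodTube ψ ε hε hεπ hψ).bwdA (toE2 d, θ) : MTorus ψ) =
      mtPt ψ (expT ((-capN ε d) • (θ : 𝔼 3))) (baseOf d) := by
  have hz : toE2 d ≠ 0 := fun h ↦ hd (toE2_eq_zero_iff.1 h)
  rw [(prodTube ψ ε hε hεπ hψ).coe_bwdA_apply (by exact hz)]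
  simp only [CircleNbhd.polarInv]
  rw [prodTube_apply_eq_mtPt_baseOf]
  have hθ : ‖(θ : 𝔼 3)‖ = 1 := by simp
  have hu : toC ((radialProjection (spherePt 1) (toE2 d) : 𝔼 2)) = (‖d‖⁻¹ : ℝ) * d := by
    rw [coe_radialProjection_of_ne_zero _ hz, toC_smul, toC_toE2, norm_toE2]
  rw [norm_toE2, univBall_zero_smul_unit hε (norm_nonneg d) hθ, hu,
    baseOf_real_mul (inv_pos.2 (norm_pos_iff.2 hd))]
  congr 2
  rw [capN, capLat]
  ring

variable {c : ℝ}

/-- **The south cap-end chart read in the old piece**: for `0 < ‖ζ‖ < 1`,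
`capEnd (ζ, a, b) = inl (bwdA …)` with `bwdA … = [expT ((-capN ε ζ) • thetaPt (c a, c b)), baseOf ζ]`. [folklore] -/
theorem coe_capEnd_point {q : ℂ × ℝ × ℝ} (h0 : q.1 ≠ 0) :
    ((prodTube ψ ε hε hεπ hψ).bwdA (toE2 q.1, thetaPt (c * q.2.1, c * q.2.2)) : MTorus ψ) =
      mtPt ψ (expT ((-capN ε q.1) • ((thetaPt (c * q.2.1, c * q.2.2) : 𝕊 2) : 𝔼 3))) (baseOf q.1) :=
  coe_bwdA_toE2 ψ hε hεπ hψ h0 _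

/-- **The north cap-end chart read in the old piece.** [folklore] -/
theorem coe_capEndN_point {q : ℂ × ℝ × ℝ} (h0 : q.1 ≠ 0) :
    ((prodTube ψ ε hε hεπ hψ).bwdA (toE2 q.1, reflS (thetaPt (c * q.2.1, c * q.2.2))) : MTorus ψ) =
      mtPt ψ (expT ((-capN ε q.1) • ((reflS (thetaPt (c * q.2.1, c * q.2.2)) : 𝕊 2) : 𝔼 3))) (baseOf q.1) :=
  coe_bwdA_toE2 ψ hε hεπ hψ h0 _

/-- The sphere-form vector of the south chart: `n₀ • thetaVec (P, Q) = (√(n₀² - (n₀P)² - (n₀Q)²), n₀ P, -n₀ Q)`. [folklore] -/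
theorem smul_thetaVec {n₀ : ℝ} (hn : 0 ≤ n₀) (p : ℝ × ℝ) :
    n₀ • thetaVec p = WithLp.toLp 2 ![Real.sqrt (n₀ ^ 2 - (n₀ * p.1) ^ 2 - (n₀ * p.2) ^ 2), n₀ * p.1, -(n₀ * p.2)] := by
  have hsq : Real.sqrt (n₀ ^ 2 - (n₀ * p.1) ^ 2 - (n₀ * p.2) ^ 2) = n₀ * Real.sqrt (1 - p.1 ^ 2 - p.2 ^ 2) := by
    rw [show n₀ ^ 2 - (n₀ * p.1) ^ 2 - (n₀ * p.2) ^ 2 = n₀ ^ 2 * (1 - p.1 ^ 2 - p.2 ^ 2) by ring,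
      Real.sqrt_mul (sq_nonneg _), Real.sqrt_sq hn]
  ext j; fin_cases j <;> simp [thetaVec, hsq]

/-- The sphere-form vector of the north chart: `n₀ • reflX (thetaVec (P, Q)) = (-√(…), n₀ P, -n₀ Q)`. [folklore] -/
theorem smul_reflX_thetaVec {n₀ : ℝ} (hn : 0 ≤ n₀) (p : ℝ × ℝ) :
    n₀ • reflX (thetaVec p) =
      WithLp.toLp 2 ![-Real.sqrt (n₀ ^ 2 - (n₀ * p.1) ^ 2 - (n₀ * p.2) ^ 2), n₀ * p.1, -(n₀ * p.2)] := by
  have hsq : Real.sqrt (n₀ ^ 2 - (n₀ * p.1) ^ 2 - (n₀ * p.2) ^ 2) = n₀ * Real.sqrt (1 - p.1 ^ 2 - p.2 ^ 2) := by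
    rw [show n₀ ^ 2 - (n₀ * p.1) ^ 2 - (n₀ * p.2) ^ 2 = n₀ ^ 2 * (1 - p.1 ^ 2 - p.2 ^ 2) by ring,
      Real.sqrt_mul (sq_nonneg _), Real.sqrt_sq hn]
  ext j; fin_cases j <;> simp [thetaVec, reflX, hsq]

end ProdTube

end Literature.Topology.FourManifolds
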